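/-
Copyright: statement-level skeleton of a published paper (lit-balaban cell, Phase-2 proof seat p25, gen 21). No proof
claims beyond what the kernel checks below.
-/
import Literature.MathematicalPhysics.QuantumFieldTheory.BalabanImbrieJaffe1984to88.BIJ88WalkRemainderActivity312
import Literature.MathematicalPhysics.QuantumFieldTheory.BalabanImbrieJaffe1984to88.BIJ88WalkWeightsN312

/-!
# `BalabanImbrieJaffe1984to88.BIJ88WalkRemainderActivityN312` — T. Bałaban, J. Imbrie, A. Jaffe, *Effective action
and cluster properties of the abelian Higgs model*, Commun. Math. Phys. **114** (1988) 257–315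
[BalabanImbrieJaffe1988], §5.14 p. 312 [PDF 56], verbatim (x2 render `lit-balaban-r16/renders/cmp114/original-p056-x2.png`):
*"By performing sufficiently many integrations by parts, we have arranged for enough small factors to beat these
large factors in the remainder terms … These considerations lead to the following estimate: |G_k(X)| ≤
c(F(X))(e^β(L^kε/ε₀)^{1/4−α})^{β′|X∖∪_cX_c|} × Π_{X_{σ_1} ⊂ X : dist(X_{σ_1}, Λ₁₂^{(k)c}) < r(e_k)} [c(L^kε)^{−m(c)}e^{−m′(c)}]."*
— **THE ℓ¹ BOUND OF THE EXPANSION AND THE LOCATED REMAINDER ACTIVITY BOUND IN AN ABSTRACT CURRENCY `N` FOR THE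
`χ′`-DIRECTIONS** (p25 gen 21; file N2 of the member-level currency generalization of row C2.Claim@312, owner r16
ruling 2026-08-23T11:27:10Z; the head of record `BIJ88WalkIneq312RemainderBdry.ineq312_remainder_bdry` UNCHANGED).

Gen 18–19's chain `expand_l1_small_free_le → sum_abs_remAt_div_weighted_le → abs_remAt_div_le` measures a
`χ′`-direction `z` by `‖z‖_∞` in exactly two hypotheses: the booking input `hBz : ‖C_p u‖ ≤ B′_p ρ_p` and the
expectation letter `hE : |𝔼_W[Π legs·(Π_{z∈dirs}∂_z)χ·e^{−V}]| ≤ K_χ·Π_z(η_χ‖z‖)·Λ`.  Everything in between (tidy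
components `wt ≤ rshape`, the extra small factor per remainder component, the local count `Σ_t Π pw ≤ W^{Φ₀}`, the
label partition) is currency-free and USED BY NAME; the two ends are re-threaded here for an ARBITRARY size
functional `N ≥ 0`, `N 0 = 0` (booking: gen 21's `BIJ88WalkWeightsN312.expand_weight_init_N`).  `N = ‖·‖_∞` gives
back gen 19; `N(z) = Σ_b|ℓ_b(z)|` is the volume-free currency of `BIJ88WalkProductCutoffVolFree312`.

statement-level skeleton of published theorems with citation tags; proofs where landed; nothing here is a claim
about the Yang–Mills mass gap

PDF held: `paper:balaban1988-cmp114-bij-abelian-higgs-effective-action` (journal page = PDF page + 256); p. 312 = PDF 56.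

CITATION HEADER (lean-in-tree rule).  lit-balaban cell (HOME `run/shared/lean/pub/lit-balaban/`), Phase 2, seat p25
gen 21; row **C2.Claim@312** of `HOME/lit-balaban-r16/ROWS-C2-part2.md` (owner r16, referee ref-5; head theorem of
record UNCHANGED; this file is a MEMBER — currency generalized to a size functional `N`).  USED BY NAME, nothing
restated: `BIJ88WalkWeightsN312.expand_weight_init_N` (p25 gen 21), `BIJ88WalkActivityShape312.{shape, expand_tidy,
envOK_zero}`, `BIJ88WalkRemainderShape312.{rshape, wt_le_rshape, sf_nonneg}`, `BIJ88WalkRemainderSmall312.{prod_rshape_le_prod_shape,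
groups_rshape_eta_le}`, `BIJ88WalkTermNorm312.prod_shape_eq`, `BIJ88WalkTermCount312.pw`,
`BIJ88WalkLocalTermCount312.expand_lsum_init_le`, `BIJ88WalkExpansionGeo311.NondegT`, `BIJ88WalkRemainderActivity312.{remAt,
rloc, nfreeOf, card_rloc, nfreeOf_rloc, remAt_div_eq_sum_fieldLaw}` (p25 gen 18–19), the §5.13 model of record
(`prec`, `src`, `corner`, `fieldLaw`, `weight`, `source`).

## What is proved (0 `sorry`, standard axioms, no new `Prop` facts; theorems only, no definitions)

* §1 **`expand_l1_small_free_le_N`** (`Σ_t |coef_t|·Π_{z∈dirs_t}N z·η_χ^{|dirs_t|}·θ^{−Σ free}·s^{−#groups} ≤ W^{Φ₀(K)}·Π_{j∈K} B_ℓ^{|obs j|}`);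
* §2 **`sum_abs_remAt_div_weighted_le_N`**, **`abs_remAt_div_le_N`** (on the §5.13 law; gen 19's
  `abs_remAt_div_le` is the instance `N = ‖·‖_∞`, `norm_nonneg`, `norm_zero`).
HONEST SCOPE: that of `BIJ88WalkRemainderActivity312` with the currency generalized: (a) `N` is any nonnegative
functional vanishing at `0` (no triangle inequality or homogeneity used); (b) `B′_p ρ_p`, `θ`, `θ_v`, `θ_w`, `η_χ`,
`ρ₀`, `N₀`, `K_χ`, `Λ` are hypothesised letters (clauses C1–C5, owner's record v2.311), none discharged here; (c)
pre-cluster-expansion ((H5)); contraction-graph components.  NOT summit progress; NOT continuum; NOT Clay.  Imports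
`BIJ88WalkRemainderActivity312`, `BIJ88WalkWeightsN312`; modifies nothing.
-/

noncomputable section

namespace Literature.MathematicalPhysics.QuantumFieldTheory.BalabanImbrieJaffe1984to88.BIJ88WalkRemainderActivityN312

open Classical MeasureTheory Matrix Finset
open scoped BigOperators
open Literature.MathematicalPhysics.QuantumFieldTheory.Balaban1983to89
open B2Eq228Conditioning (weight source)
open BIJ88PolymerRep5134 (corner)
open BIJ88PolymerRep5134Gauss (prec src)
open BIJ88SlotMomentsGauss308 (fieldLaw integral_density_pos)
open BIJ88VertexIbp311 (vexp)
open BIJ88WickDerivatives305 (dlist)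
open BIJ88VertexComponents311 (maxArity)
open BIJ88Resummation312 (sum_map_ite sum_map_finset_sum_comm)
open BIJ88WalkRun311 BIJ88WalkGeometry311 BIJ88WalkExpansion311 BIJ88WalkExpansionGeo311 BIJ88WalkWeights312
  BIJ88WalkActivityShape312 BIJ88WalkTermCount312 BIJ88WalkLocalTermCount312 BIJ88WalkTermNorm312
  BIJ88WalkRemainderShape312 BIJ88WalkRemainderSmall312 BIJ88WalkRemainderActivity312 BIJ88WalkWeightsN312

variable {S : Type} [Fintype S] {ι : Type} [Fintype ι] {κ : Type} [LinearOrder κ] {P : Type} [Fintype P]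
  {β : Type} [DecidableEq β]

/-! ## §1  The ℓ¹ norm of the expansion in the currency `N` -/
section L1
variable {Cov : P → Matrix S S ℝ} {trig : P → Bool} {f : S → ℝ} {c : ι → ℝ} {legs : ι → List (S → ℝ)}
  {obs : κ → List (S → ℝ)} {M : ℕ} {oc : κ → Finset β} {vc : ι → Finset β} {reg : P → Finset β}
  {Bl θ θv θw ηχ : ℝ}

omit [Fintype S] [Fintype ι] [LinearOrder κ] [Fintype P] in
/-- `Π_{X ∈ m} (shape X · s) = Π_{X ∈ m} shape X · s^{#m}` (bookkeeping). [folklore] -/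
private theorem prod_map_shape_mul' (s : ℝ) (m : Multiset (WGrp S κ ι P)) :
    (m.map fun X => shape obs oc vc reg Bl θ X * s).prod = (m.map (shape obs oc vc reg Bl θ)).prod * s ^ Multiset.card m := by
  rw [Multiset.prod_map_mul, Multiset.map_const', Multiset.prod_replicate]

/-- **ALL TERMS IN THE CURRENCY `N`, SIZED IN UNITS OF ONE SMALL FACTOR PER UNCOVERED CUBE AND ONE PER REMAINDER
COMPONENT**: under the hypotheses of `BIJ88WalkRemainderSmall312.expand_l1_small_free_le` with the booking input
`hBz` replaced by `N(C_p u) ≤ B′_p ρ_p` on `Dir` for a size functional `N ≥ 0`, `N 0 = 0`: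
`Σ_{t ∈ expand 0 K} |coef_t|·Π_{z∈dirs_t}N z·η_χ^{|dirs_t|}·θ^{−Σ_X #(cubes X ∖ obs cubes)}·s^{−#t.groups} ≤ W^{Φ₀(K)}·Π_{j∈K} B_ℓ^{|obs j|}`,
`s = max(η_χ, θ_v^M, θ_w)`. [cite: BalabanImbrieJaffe1988, §5.14 p.312] -/
theorem expand_l1_small_free_le_N {N : (S → ℝ) → ℝ} (hN0 : ∀ z, 0 ≤ N z) (hNz : N 0 = 0)
    {Dir : Set (S → ℝ)} {B' ρ : P → ℝ} {cV : ι → ℝ} {ρ₀ W : ℝ} {N₀ : ℕ}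
    (hθ0 : 0 < θ) (hθ1 : θ ≤ 1) (hBl : 1 ≤ Bl) (hB0 : ∀ p, 0 ≤ B' p) (hρ : ∀ p, 0 ≤ ρ p) (hcV0 : ∀ m, 0 ≤ cV m)
    (hη0 : 0 ≤ ηχ) (hη1 : ηχ ≤ 1) (hθv : 0 < θv) (hθv1 : θv ≤ 1) (hθw : 0 < θw) (hθw1 : θw ≤ 1)
    (hB : ∀ p, ∀ u ∈ Dir, ∀ w ∈ Dir, |(Cov p *ᵥ u) ⬝ᵥ w| ≤ B' p * ρ p)
    (hBf : ∀ p, ∀ u ∈ Dir, |(Cov p *ᵥ u) ⬝ᵥ f| ≤ B' p * ρ p) (hBzN : ∀ p, ∀ u ∈ Dir, N (Cov p *ᵥ u) ≤ B' p * ρ p)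
    (hcV : ∀ m, |c m| ≤ cV m) (hobs : ∀ j, ∀ w ∈ obs j, w ∈ Dir) (hlegs : ∀ m, ∀ w ∈ legs m, w ∈ Dir)
    (hloc : ∀ p, trig p = false → B' p ≤ Bl ∧ reg p = ∅) (hwalk : ∀ p, trig p = true → B' p ≤ θw * θ ^ (reg p).card)
    (hvert : ∀ m, cV m * Bl ^ (legs m).length ≤ θv * θ ^ (vc m).card) (hρ₀0 : 0 ≤ ρ₀)
    (hρ₀ : ∀ u ∈ Dir, (∑ p ∈ univ.filter (fun p => Cov p *ᵥ u ≠ 0), ρ p) ≤ ρ₀)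
    (hN₀ : ∀ p, ∀ u ∈ Dir,
      (∑ m, ((range (legs m).length).filter fun j => (Cov p *ᵥ u) ⬝ᵥ (legs m).getD j 0 ≠ 0).card) ≤ N₀)
    (K : Finset κ) (hW1 : 1 ≤ W)
    (hW : ρ₀ * ((∑ j ∈ K, ((obs j).length + 1 + M * maxArity legs) + N₀ : ℕ) : ℝ) ≤ W) :
    ((expand Cov trig f c legs obs M 0 K).map fun t =>
        |t.coef| * (t.dirs.map N).prod * ηχ ^ t.dirs.length
          * (θ ^ ((t.consts + t.groups).map fun X => (cubes oc vc reg X \ X.lab.biUnion oc).card).sum)⁻¹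
          * ((max ηχ (max (θv ^ M) θw)) ^ Multiset.card t.groups)⁻¹).sum
      ≤ W ^ (∑ j ∈ K, ((obs j).length + 1 + M * maxArity legs)) * ∏ j ∈ K, Bl ^ (obs j).length := by
  set s := max ηχ (max (θv ^ M) θw) with hs
  have hs0 : 0 < s := lt_max_of_lt_right (lt_max_of_lt_right hθw)
  have hC : 0 < ∏ j ∈ K, Bl ^ (obs j).length := prod_pos fun j _ => pow_pos (zero_lt_one.trans_le hBl) _
  have hBρ0 : ∀ p, 0 ≤ B' p * ρ p := fun p => mul_nonneg (hB0 p) (hρ p)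
  have hsh0 : ∀ g : WGrp S κ ι P, 0 < shape obs oc vc reg Bl θ g := fun g =>
    mul_pos (prod_pos fun j _ => pow_pos (zero_lt_one.trans_le hBl) _) (pow_pos hθ0 _)
  have hpw0 : ∀ m : Multiset (WGrp S κ ι P), 0 ≤ (m.map (pw ρ)).prod := fun m =>
    Multiset.prod_nonneg fun x hx => by
      obtain ⟨g, -, rfl⟩ := Multiset.mem_map.1 hx
      exact Multiset.prod_nonneg fun y hy => by obtain ⟨p, -, rfl⟩ := Multiset.mem_map.1 hy; exact hρ p
  have hwt0 : ∀ g : WGrp S κ ι P, 0 ≤ wt B' cV g := fun g =>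
    mul_nonneg (Multiset.prod_nonneg fun x hx => by obtain ⟨p, -, rfl⟩ := Multiset.mem_map.1 hx; exact hB0 p)
      (Multiset.prod_nonneg fun x hx => by obtain ⟨m, -, rfl⟩ := Multiset.mem_map.1 hx; exact hcV0 m)
  have hr0 : ∀ m : Multiset (WGrp S κ ι P), 0 ≤ (m.map (rshape trig θv θw obs oc vc reg Bl θ)).prod := fun m =>
    Multiset.prod_nonneg fun x hx => by
      obtain ⟨g, -, rfl⟩ := Multiset.mem_map.1 hx
      exact mul_nonneg (hsh0 g).le (sf_nonneg hθv.le hθw.le g)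
  have hsplit : ∀ g : WGrp S κ ι P, wt (fun p => B' p * ρ p) cV g = wt B' cV g * pw ρ g := fun g => by
    simp only [wt, pw, Multiset.prod_map_mul]; ring
  -- pointwise: each summand is at most `(Π_j B_ℓ^{|obs j|}) ·` the counting weight of the term
  have hpt : ∀ t ∈ expand Cov trig f c legs obs M 0 K,
      |t.coef| * (t.dirs.map N).prod * ηχ ^ t.dirs.length
          * (θ ^ ((t.consts + t.groups).map fun X => (cubes oc vc reg X \ X.lab.biUnion oc).card).sum)⁻¹
          * (s ^ Multiset.card t.groups)⁻¹
        ≤ (∏ j ∈ K, Bl ^ (obs j).length)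
          * (if NondegT t then ((t.consts + t.groups).map (pw ρ)).prod else 0) := by
    intro t ht
    set F := θ ^ ((t.consts + t.groups).map fun X => (cubes oc vc reg X \ X.lab.biUnion oc).card).sum with hF
    have hF0 : 0 < F := pow_pos hθ0 _
    have hG0 : 0 < s ^ Multiset.card t.groups := pow_pos hs0 _
    by_cases hT : NondegT t
    · rw [if_pos hT]
      -- (i) the weight invariant in the currency `N`, with `B := B′·ρ`, split into `wt(B′)·pw(ρ)`
      have hw := expand_weight_init_N (trig := trig) (M := M) hN0 (B := fun p => B' p * ρ p) hBρ0 hcV0 hB hBf hBzN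
        hcV hobs hlegs K t ht
      rw [← Multiset.prod_add, ← Multiset.map_add] at hw
      have e : ((t.consts + t.groups).map (wt (fun p => B' p * ρ p) cV)).prod
          = ((t.consts + t.groups).map (wt B' cV)).prod * ((t.consts + t.groups).map (pw ρ)).prod := by
        rw [← Multiset.prod_map_mul]
        exact congrArg _ (Multiset.map_congr rfl fun g _ => hsplit g)
      -- (ii) tidy components: `wt(B′) ≤ rshape`
      obtain ⟨hTc, hTg⟩ := expand_tidy (Cov := Cov) (trig := trig) (f := f) (c := c) (M := M) _ 0 K
        (Nat.lt_succ_self _) (envOK_zero K) t ht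
      have hTidy : ∀ g ∈ t.consts + t.groups, Tidy obs legs g := fun g hg => by
        rcases Multiset.mem_add.1 hg with hg | hg
        · exact hTc g hg
        · exact hTg g hg
      have hle : ((t.consts + t.groups).map (wt B' cV)).prod
          ≤ ((t.consts + t.groups).map (rshape trig θv θw obs oc vc reg Bl θ)).prod :=
        Multiset.prod_map_le_prod_map₀ _ _ (fun g _ => hwt0 g) fun g hg =>
          wt_le_rshape hθ0 hθ1 hBl hB0 hcV0 hθv.le hθw.le hloc hwalk hvert g (hTidy g hg)
      have hA : |t.coef| * (t.dirs.map N).prod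
          ≤ ((t.consts + t.groups).map (rshape trig θv θw obs oc vc reg Bl θ)).prod
            * ((t.consts + t.groups).map (pw ρ)).prod :=
        (hw.trans_eq e).trans (mul_le_mul_of_nonneg_right hle (hpw0 _))
      -- (iii) the `χ′`-charge and the record small factors: one extra small factor per remainder component
      have key : ηχ ^ t.dirs.length * ((t.consts + t.groups).map (rshape trig θv θw obs oc vc reg Bl θ)).prod
          ≤ (t.consts.map (shape obs oc vc reg Bl θ)).prod
              * (t.groups.map fun X => shape obs oc vc reg Bl θ X * s).prod := by
        rw [Multiset.map_add, Multiset.prod_add]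
        have hc := prod_rshape_le_prod_shape (trig := trig) (obs := obs) (oc := oc) (vc := vc) (reg := reg) hθ0 hBl
          hθv.le hθv1 hθw.le hθw1 t.consts
        have hg := groups_rshape_eta_le (Cov := Cov) (trig := trig) (f := f) (c := c) (legs := legs) (obs := obs)
          (oc := oc) (vc := vc) (reg := reg) hθ0 hBl hη0 hη1 hθv.le hθv1 hθw.le hθw1 K t ht
        calc ηχ ^ t.dirs.length * ((t.consts.map (rshape trig θv θw obs oc vc reg Bl θ)).prod
                * (t.groups.map (rshape trig θv θw obs oc vc reg Bl θ)).prod)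
            = (t.consts.map (rshape trig θv θw obs oc vc reg Bl θ)).prod
                * ((t.groups.map (rshape trig θv θw obs oc vc reg Bl θ)).prod * ηχ ^ t.dirs.length) := by ring
          _ ≤ _ := mul_le_mul hc hg (mul_nonneg (hr0 _) (pow_nonneg hη0 _))
                (Multiset.prod_nonneg fun x hx => by obtain ⟨g, -, rfl⟩ := Multiset.mem_map.1 hx; exact (hsh0 g).le)
      -- (iv) labels partition `K`: `Π_{X_c} shape · Π_{X_r}(shape·s) = (Π_j B_ℓ^{|obs j|})·θ^{Σ free}·s^{#groups}`
      have e2 : (t.consts.map (shape obs oc vc reg Bl θ)).prod * (t.groups.map fun X => shape obs oc vc reg Bl θ X * s).prod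
          = (∏ j ∈ K, Bl ^ (obs j).length) * F * s ^ Multiset.card t.groups := by
        rw [prod_map_shape_mul', ← mul_assoc, ← Multiset.prod_add, ← Multiset.map_add,
          prod_shape_eq (Cov := Cov) (trig := trig) (f := f) (c := c) (legs := legs) (M := M) Bl θ K t ht]
      have hη : 0 ≤ ηχ ^ t.dirs.length * (F⁻¹ * (s ^ Multiset.card t.groups)⁻¹) :=
        mul_nonneg (pow_nonneg hη0 _) (mul_nonneg (inv_nonneg.2 hF0.le) (inv_nonneg.2 hG0.le))
      calc |t.coef| * (t.dirs.map N).prod * ηχ ^ t.dirs.length * F⁻¹ * (s ^ Multiset.card t.groups)⁻¹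
          = |t.coef| * (t.dirs.map N).prod * (ηχ ^ t.dirs.length * (F⁻¹ * (s ^ Multiset.card t.groups)⁻¹)) := by ring
        _ ≤ ((t.consts + t.groups).map (rshape trig θv θw obs oc vc reg Bl θ)).prod
              * ((t.consts + t.groups).map (pw ρ)).prod
              * (ηχ ^ t.dirs.length * (F⁻¹ * (s ^ Multiset.card t.groups)⁻¹)) := mul_le_mul_of_nonneg_right hA hη
        _ = ηχ ^ t.dirs.length * ((t.consts + t.groups).map (rshape trig θv θw obs oc vc reg Bl θ)).prod
              * (F⁻¹ * (s ^ Multiset.card t.groups)⁻¹) * ((t.consts + t.groups).map (pw ρ)).prod := by ring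
        _ ≤ (∏ j ∈ K, Bl ^ (obs j).length) * F * s ^ Multiset.card t.groups
              * (F⁻¹ * (s ^ Multiset.card t.groups)⁻¹) * ((t.consts + t.groups).map (pw ρ)).prod :=
            mul_le_mul_of_nonneg_right (mul_le_mul_of_nonneg_right (key.trans_eq e2)
              (mul_nonneg (inv_nonneg.2 hF0.le) (inv_nonneg.2 hG0.le))) (hpw0 _)
        _ = (∏ j ∈ K, Bl ^ (obs j).length) * ((t.consts + t.groups).map (pw ρ)).prod
              * (F * F⁻¹) * (s ^ Multiset.card t.groups * (s ^ Multiset.card t.groups)⁻¹) := by ring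
        _ = _ := by rw [mul_inv_cancel₀ hF0.ne', mul_inv_cancel₀ hG0.ne', mul_one, mul_one]
    · -- a degenerate term has size zero (`N 0 = 0`)
      rw [if_neg hT, mul_zero]
      refine le_of_eq ?_
      simp only [NondegT, not_and_or, not_forall, not_not, exists_prop] at hT
      rcases hT with hc | ⟨z, hz, rfl⟩
      · rw [hc, abs_zero, zero_mul, zero_mul, zero_mul, zero_mul]
      · rw [List.prod_eq_zero (List.mem_map.2 ⟨0, hz, hNz⟩), mul_zero, zero_mul, zero_mul, zero_mul]
  calc ((expand Cov trig f c legs obs M 0 K).map fun t =>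
          |t.coef| * (t.dirs.map N).prod * ηχ ^ t.dirs.length
            * (θ ^ ((t.consts + t.groups).map fun X => (cubes oc vc reg X \ X.lab.biUnion oc).card).sum)⁻¹
            * (s ^ Multiset.card t.groups)⁻¹).sum
      ≤ ((expand Cov trig f c legs obs M 0 K).map fun t => (∏ j ∈ K, Bl ^ (obs j).length)
          * (if NondegT t then ((t.consts + t.groups).map (pw ρ)).prod else 0)).sum :=
        Multiset.sum_map_le_sum_map _ _ hpt
    _ = (∏ j ∈ K, Bl ^ (obs j).length) * ((expand Cov trig f c legs obs M 0 K).map fun t =>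
          if NondegT t then ((t.consts + t.groups).map (pw ρ)).prod else 0).sum := by rw [Multiset.sum_map_mul_left]
    _ ≤ (∏ j ∈ K, Bl ^ (obs j).length) * W ^ ∑ j ∈ K, ((obs j).length + 1 + M * maxArity legs) :=
        mul_le_mul_of_nonneg_left
          (expand_lsum_init_le (trig := trig) (f := f) (c := c) hobs hlegs hρ hρ₀0 hρ₀ hN₀ K hW1 hW) hC.le
    _ = _ := mul_comm _ _

end L1

/-! ## §2  On the law of the fields of the §5.13 model: the located remainder activity in the currency `N` -/

section Law

variable {α I : Type} [Fintype α] [DecidableEq α] [Fintype I] [DecidableEq I]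
  {blk : α → I} {Δ : Matrix α α ℝ} {ℱ : α → ℝ} {W : Finset I}

omit [Fintype α] [DecidableEq α] [Fintype I] [DecidableEq I] in
/-- `Π_{z ∈ D} (η·N z) = η^{|D|}·Π_{z ∈ D} N z` (bookkeeping). [folklore] -/
private theorem prod_map_const_mul_N (N : ({x : α // blk x ∈ W} → ℝ) → ℝ) (η : ℝ) :
    ∀ D : List ({x : α // blk x ∈ W} → ℝ), (D.map fun z => η * N z).prod = η ^ D.length * (D.map N).prod
  | [] => by simp
  | z :: D => by rw [List.map_cons, List.prod_cons, List.map_cons, List.prod_cons, prod_map_const_mul_N N η D,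
      List.length_cons, pow_succ]; ring

/-- **THE LOCATED REMAINDER FAMILIES ARE SUMMABLE AGAINST THE INVERSE OF ALL THE SMALL FACTORS, IN THE CURRENCY `N`**:
on the §5.13 law, under the hypotheses of `expand_l1_small_free_le_N` (source `src` as `f`) and the expectation
letter `|𝔼_W[Π_{legs}Φ·(Π_{dirs t}∂)χ·e^{−V}]| ≤ K_χ·Π_{z∈dirs t}(η_χ·N z)·Λ` for the remainder terms of `expand 0 O`:
`Σ_{𝒳 ∈ 𝔉} |remAt(O,𝒳)/Z|·(θ^{nfree 𝒳})⁻¹·(s^{#𝒳})⁻¹ ≤ K_χ·Λ·W^{Φ₀(O)}·Π_{j∈O} B_ℓ^{|obs j|}`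
(`N = ‖·‖_∞`: `BIJ88WalkRemainderActivity312.sum_abs_remAt_div_weighted_le`). [cite: BalabanImbrieJaffe1988, §5.14 p.312] -/
theorem sum_abs_remAt_div_weighted_le_N (hPD : (prec blk Δ W (corner ℝ W)).PosDef)
    {N : ({x : α // blk x ∈ W} → ℝ) → ℝ} (hN0 : ∀ z, 0 ≤ N z) (hNz : N 0 = 0)
    {Cov : P → Matrix {x : α // blk x ∈ W} {x : α // blk x ∈ W} ℝ} {trig : P → Bool} {c : ι → ℝ}
    {legs : ι → List ({x : α // blk x ∈ W} → ℝ)} {obs : κ → List ({x : α // blk x ∈ W} → ℝ)} {M : ℕ}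
    {χ : ({x : α // blk x ∈ W} → ℝ) → ℝ} {oc : κ → Finset β} {vc : ι → Finset β} {reg : P → Finset β}
    {Dir : Set ({x : α // blk x ∈ W} → ℝ)} {B' ρ : P → ℝ} {cV : ι → ℝ} {Bl θ θv θw ηχ ρ₀ Wc Kχ Λ : ℝ} {N₀ : ℕ}
    (hθ0 : 0 < θ) (hθ1 : θ ≤ 1) (hBl : 1 ≤ Bl) (hB0 : ∀ p, 0 ≤ B' p) (hρ : ∀ p, 0 ≤ ρ p) (hcV0 : ∀ m, 0 ≤ cV m)
    (hη0 : 0 ≤ ηχ) (hη1 : ηχ ≤ 1) (hθv : 0 < θv) (hθv1 : θv ≤ 1) (hθw : 0 < θw) (hθw1 : θw ≤ 1)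
    (hB : ∀ p, ∀ u ∈ Dir, ∀ w ∈ Dir, |(Cov p *ᵥ u) ⬝ᵥ w| ≤ B' p * ρ p)
    (hBf : ∀ p, ∀ u ∈ Dir, |(Cov p *ᵥ u) ⬝ᵥ src blk ℱ W| ≤ B' p * ρ p)
    (hBzN : ∀ p, ∀ u ∈ Dir, N (Cov p *ᵥ u) ≤ B' p * ρ p)
    (hcV : ∀ m, |c m| ≤ cV m) (hobs : ∀ j, ∀ w ∈ obs j, w ∈ Dir) (hlegs : ∀ m, ∀ w ∈ legs m, w ∈ Dir)
    (hloc : ∀ p, trig p = false → B' p ≤ Bl ∧ reg p = ∅) (hwalk : ∀ p, trig p = true → B' p ≤ θw * θ ^ (reg p).card)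
    (hvert : ∀ m, cV m * Bl ^ (legs m).length ≤ θv * θ ^ (vc m).card) (hρ₀0 : 0 ≤ ρ₀)
    (hρ₀ : ∀ u ∈ Dir, (∑ p ∈ univ.filter (fun p => Cov p *ᵥ u ≠ 0), ρ p) ≤ ρ₀)
    (hN₀ : ∀ p, ∀ u ∈ Dir,
      (∑ m, ((range (legs m).length).filter fun j => (Cov p *ᵥ u) ⬝ᵥ (legs m).getD j 0 ≠ 0).card) ≤ N₀)
    (O : Finset κ) (hW1 : 1 ≤ Wc)
    (hW : ρ₀ * ((∑ j ∈ O, ((obs j).length + 1 + M * maxArity legs) + N₀ : ℕ) : ℝ) ≤ Wc)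
    (hKχ : 0 ≤ Kχ) (hΛ : 0 ≤ Λ)
    (hE : ∀ t ∈ expand Cov trig (src blk ℱ W) c legs obs M 0 O, t.consts = 0 →
      |∫ φ, ((t.groups.map fun h => (h.pend : Multiset _)).sum.map fun w => φ ⬝ᵥ w).prod
          * (dlist t.dirs χ φ * vexp c legs φ) ∂(fieldLaw blk Δ ℱ W)|
        ≤ Kχ * (t.dirs.map fun z => ηχ * N z).prod * Λ)
    (𝔉 : Finset (Multiset (Finset κ × Finset β))) :
    ∑ 𝒳 ∈ 𝔉, |remAt (prec blk Δ W (corner ℝ W)) Cov trig (src blk ℱ W) c legs obs M χ oc vc reg [] 0 O 𝒳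
          / ∫ φ, weight (prec blk Δ W (corner ℝ W)) φ * source (src blk ℱ W) φ|
        * ((θ ^ nfreeOf oc 𝒳)⁻¹ * ((max ηχ (max (θv ^ M) θw)) ^ Multiset.card 𝒳)⁻¹)
      ≤ Kχ * Λ * (Wc ^ (∑ j ∈ O, ((obs j).length + 1 + M * maxArity legs)) * ∏ j ∈ O, Bl ^ (obs j).length) := by
  have hs0 : 0 < max ηχ (max (θv ^ M) θw) := lt_max_of_lt_right (lt_max_of_lt_right hθw)
  have hfree := expand_l1_small_free_le_N (oc := oc) (vc := vc) (reg := reg) hN0 hNz hθ0 hθ1 hBl hB0 hρ hcV0 hη0 hη1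
    hθv hθv1 hθw hθw1 hB hBf hBzN hcV hobs hlegs hloc hwalk hvert hρ₀0 hρ₀ hN₀ O hW1 hW
  -- shorthand for the per-family weight and the per-term normalized expectation
  set w : Multiset (Finset κ × Finset β) → ℝ := fun 𝒳 =>
    (θ ^ nfreeOf oc 𝒳)⁻¹ * ((max ηχ (max (θv ^ M) θw)) ^ Multiset.card 𝒳)⁻¹ with hw
  have hw0 : ∀ 𝒳, 0 ≤ w 𝒳 := fun 𝒳 => mul_nonneg (inv_nonneg.2 (pow_nonneg hθ0.le _)) (inv_nonneg.2 (pow_nonneg hs0.le _))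
  obtain ⟨E, hEdef⟩ : ∃ E : WTerm {x : α // blk x ∈ W} κ ι P → ℝ, ∀ t,
      E t = ∫ φ, ((t.groups.map fun h => (h.pend : Multiset _)).sum.map fun w => φ ⬝ᵥ w).prod
        * (dlist t.dirs χ φ * vexp c legs φ) ∂(fieldLaw blk Δ ℱ W) := ⟨_, fun _ => rfl⟩
  have hE' : ∀ t ∈ expand Cov trig (src blk ℱ W) c legs obs M 0 O, t.consts = 0 →
      |E t| ≤ Kχ * (t.dirs.map fun z => ηχ * N z).prod * Λ := fun t ht hc => by
    rw [hEdef]; exact hE t ht hc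
  -- each family: `|remAt/Z| ≤ Σ_{t located at 𝒳} |coef_t|·|E_t|`
  have hfam : ∀ 𝒳 ∈ 𝔉, |remAt (prec blk Δ W (corner ℝ W)) Cov trig (src blk ℱ W) c legs obs M χ oc vc reg [] 0 O 𝒳
        / ∫ φ, weight (prec blk Δ W (corner ℝ W)) φ * source (src blk ℱ W) φ| * w 𝒳
      ≤ ((expand Cov trig (src blk ℱ W) c legs obs M 0 O).map fun t =>
          (if t.consts = 0 ∧ rloc oc vc reg t = 𝒳 then |t.coef| * |E t| else 0) * w 𝒳).sum := by
    intro 𝒳 _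
    rw [remAt_div_eq_sum_fieldLaw hPD]
    refine (mul_le_mul_of_nonneg_right Multiset.abs_sum_le_sum_abs (hw0 𝒳)).trans ?_
    rw [Multiset.map_map, ← Multiset.sum_map_mul_right]
    refine Multiset.sum_map_le_sum_map _ _ fun t _ => mul_le_mul_of_nonneg_right ?_ (hw0 𝒳)
    simp only [Function.comp_apply]
    split_ifs
    · rw [abs_mul, hEdef]
    · rw [abs_zero]
  -- each term: the families it is located at sum to at most its size in units of all the small factors
  have hterm : ∀ t ∈ expand Cov trig (src blk ℱ W) c legs obs M 0 O,
      ∑ 𝒳 ∈ 𝔉, (if t.consts = 0 ∧ rloc oc vc reg t = 𝒳 then |t.coef| * |E t| else 0) * w 𝒳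
        ≤ Kχ * Λ * (|t.coef| * (t.dirs.map N).prod * ηχ ^ t.dirs.length
          * (θ ^ ((t.consts + t.groups).map fun X => (cubes oc vc reg X \ X.lab.biUnion oc).card).sum)⁻¹
          * ((max ηχ (max (θv ^ M) θw)) ^ Multiset.card t.groups)⁻¹) := by
    intro t ht
    have hsz : 0 ≤ |t.coef| * (t.dirs.map N).prod * ηχ ^ t.dirs.length
        * (θ ^ ((t.consts + t.groups).map fun X => (cubes oc vc reg X \ X.lab.biUnion oc).card).sum)⁻¹
        * ((max ηχ (max (θv ^ M) θw)) ^ Multiset.card t.groups)⁻¹ :=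
      mul_nonneg (mul_nonneg (mul_nonneg (mul_nonneg (abs_nonneg _) (List.prod_nonneg fun x hx => by
        obtain ⟨z, -, rfl⟩ := List.mem_map.1 hx; exact hN0 z)) (pow_nonneg hη0 _))
        (inv_nonneg.2 (pow_nonneg hθ0.le _))) (inv_nonneg.2 (pow_nonneg hs0.le _))
    by_cases hc : t.consts = 0
    · have e : ∀ 𝒳 ∈ 𝔉, (if t.consts = 0 ∧ rloc oc vc reg t = 𝒳 then |t.coef| * |E t| else 0) * w 𝒳
          = if rloc oc vc reg t = 𝒳 then |t.coef| * |E t| * w 𝒳 else 0 := fun 𝒳 _ => by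
        by_cases hX : rloc oc vc reg t = 𝒳
        · rw [if_pos ⟨hc, hX⟩, if_pos hX]
        · rw [if_neg fun h => hX h.2, if_neg hX, zero_mul]
      rw [Finset.sum_congr rfl e, Finset.sum_ite_eq]
      split_ifs
      · -- the weight of the term's own family is the inverse of the term's small factors
        have hwt : w (rloc oc vc reg t)
            = (θ ^ ((t.consts + t.groups).map fun X => (cubes oc vc reg X \ X.lab.biUnion oc).card).sum)⁻¹
              * ((max ηχ (max (θv ^ M) θw)) ^ Multiset.card t.groups)⁻¹ := by
          rw [hw]
          simp only [nfreeOf_rloc, card_rloc, hc, zero_add]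
        have hEt := hE' t ht hc
        rw [prod_map_const_mul_N] at hEt
        calc |t.coef| * |E t| * w (rloc oc vc reg t)
            ≤ |t.coef| * (Kχ * (ηχ ^ t.dirs.length * (t.dirs.map N).prod) * Λ) * w (rloc oc vc reg t) :=
              mul_le_mul_of_nonneg_right (mul_le_mul_of_nonneg_left hEt (abs_nonneg _)) (hw0 _)
          _ = _ := by rw [hwt]; ring
      · exact mul_nonneg (mul_nonneg hKχ hΛ) hsz
    · rw [Finset.sum_eq_zero fun 𝒳 _ => by rw [if_neg fun h => hc h.1, zero_mul]]
      exact mul_nonneg (mul_nonneg hKχ hΛ) hsz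
  calc ∑ 𝒳 ∈ 𝔉, |remAt (prec blk Δ W (corner ℝ W)) Cov trig (src blk ℱ W) c legs obs M χ oc vc reg [] 0 O 𝒳
            / ∫ φ, weight (prec blk Δ W (corner ℝ W)) φ * source (src blk ℱ W) φ| * w 𝒳
      ≤ ∑ 𝒳 ∈ 𝔉, ((expand Cov trig (src blk ℱ W) c legs obs M 0 O).map fun t =>
          (if t.consts = 0 ∧ rloc oc vc reg t = 𝒳 then |t.coef| * |E t| else 0) * w 𝒳).sum := Finset.sum_le_sum hfam
    _ = ((expand Cov trig (src blk ℱ W) c legs obs M 0 O).map fun t =>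
          ∑ 𝒳 ∈ 𝔉, (if t.consts = 0 ∧ rloc oc vc reg t = 𝒳 then |t.coef| * |E t| else 0) * w 𝒳).sum :=
        (sum_map_finset_sum_comm _ _ _).symm
    _ ≤ ((expand Cov trig (src blk ℱ W) c legs obs M 0 O).map fun t =>
          Kχ * Λ * (|t.coef| * (t.dirs.map N).prod * ηχ ^ t.dirs.length
            * (θ ^ ((t.consts + t.groups).map fun X => (cubes oc vc reg X \ X.lab.biUnion oc).card).sum)⁻¹
            * ((max ηχ (max (θv ^ M) θw)) ^ Multiset.card t.groups)⁻¹)).sum := Multiset.sum_map_le_sum_map _ _ hterm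
    _ = Kχ * Λ * ((expand Cov trig (src blk ℱ W) c legs obs M 0 O).map fun t =>
          |t.coef| * (t.dirs.map N).prod * ηχ ^ t.dirs.length
            * (θ ^ ((t.consts + t.groups).map fun X => (cubes oc vc reg X \ X.lab.biUnion oc).card).sum)⁻¹
            * ((max ηχ (max (θv ^ M) θw)) ^ Multiset.card t.groups)⁻¹).sum := by rw [Multiset.sum_map_mul_left]
    _ ≤ _ := mul_le_mul_of_nonneg_left hfree (mul_nonneg hKχ hΛ)

/-- **THE REMAINDER PART AT ONE LOCATED FAMILY, IN THE CURRENCY `N`** (the printed three factors and one extra small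
factor per remainder component): `|remAt(O,𝒳)/Z| ≤ K_χ·Λ·W^{Φ₀(O)}·(Π_{j∈O} B_ℓ^{|obs j|})·θ^{Σ_r #(X_r ∖ obs cubes)}·s^{#𝒳}`
(`N = ‖·‖_∞`: `BIJ88WalkRemainderActivity312.abs_remAt_div_le`). [cite: BalabanImbrieJaffe1988, §5.14 p.312] -/
theorem abs_remAt_div_le_N (hPD : (prec blk Δ W (corner ℝ W)).PosDef)
    {N : ({x : α // blk x ∈ W} → ℝ) → ℝ} (hN0 : ∀ z, 0 ≤ N z) (hNz : N 0 = 0)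
    {Cov : P → Matrix {x : α // blk x ∈ W} {x : α // blk x ∈ W} ℝ} {trig : P → Bool} {c : ι → ℝ}
    {legs : ι → List ({x : α // blk x ∈ W} → ℝ)} {obs : κ → List ({x : α // blk x ∈ W} → ℝ)} {M : ℕ}
    {χ : ({x : α // blk x ∈ W} → ℝ) → ℝ} {oc : κ → Finset β} {vc : ι → Finset β} {reg : P → Finset β}
    {Dir : Set ({x : α // blk x ∈ W} → ℝ)} {B' ρ : P → ℝ} {cV : ι → ℝ} {Bl θ θv θw ηχ ρ₀ Wc Kχ Λ : ℝ} {N₀ : ℕ}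
    (hθ0 : 0 < θ) (hθ1 : θ ≤ 1) (hBl : 1 ≤ Bl) (hB0 : ∀ p, 0 ≤ B' p) (hρ : ∀ p, 0 ≤ ρ p) (hcV0 : ∀ m, 0 ≤ cV m)
    (hη0 : 0 ≤ ηχ) (hη1 : ηχ ≤ 1) (hθv : 0 < θv) (hθv1 : θv ≤ 1) (hθw : 0 < θw) (hθw1 : θw ≤ 1)
    (hB : ∀ p, ∀ u ∈ Dir, ∀ w ∈ Dir, |(Cov p *ᵥ u) ⬝ᵥ w| ≤ B' p * ρ p)
    (hBf : ∀ p, ∀ u ∈ Dir, |(Cov p *ᵥ u) ⬝ᵥ src blk ℱ W| ≤ B' p * ρ p)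
    (hBzN : ∀ p, ∀ u ∈ Dir, N (Cov p *ᵥ u) ≤ B' p * ρ p)
    (hcV : ∀ m, |c m| ≤ cV m) (hobs : ∀ j, ∀ w ∈ obs j, w ∈ Dir) (hlegs : ∀ m, ∀ w ∈ legs m, w ∈ Dir)
    (hloc : ∀ p, trig p = false → B' p ≤ Bl ∧ reg p = ∅) (hwalk : ∀ p, trig p = true → B' p ≤ θw * θ ^ (reg p).card)
    (hvert : ∀ m, cV m * Bl ^ (legs m).length ≤ θv * θ ^ (vc m).card) (hρ₀0 : 0 ≤ ρ₀)
    (hρ₀ : ∀ u ∈ Dir, (∑ p ∈ univ.filter (fun p => Cov p *ᵥ u ≠ 0), ρ p) ≤ ρ₀)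
    (hN₀ : ∀ p, ∀ u ∈ Dir,
      (∑ m, ((range (legs m).length).filter fun j => (Cov p *ᵥ u) ⬝ᵥ (legs m).getD j 0 ≠ 0).card) ≤ N₀)
    (O : Finset κ) (hW1 : 1 ≤ Wc)
    (hW : ρ₀ * ((∑ j ∈ O, ((obs j).length + 1 + M * maxArity legs) + N₀ : ℕ) : ℝ) ≤ Wc)
    (hKχ : 0 ≤ Kχ) (hΛ : 0 ≤ Λ)
    (hE : ∀ t ∈ expand Cov trig (src blk ℱ W) c legs obs M 0 O, t.consts = 0 →
      |∫ φ, ((t.groups.map fun h => (h.pend : Multiset _)).sum.map fun w => φ ⬝ᵥ w).prod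
          * (dlist t.dirs χ φ * vexp c legs φ) ∂(fieldLaw blk Δ ℱ W)|
        ≤ Kχ * (t.dirs.map fun z => ηχ * N z).prod * Λ)
    (𝒳 : Multiset (Finset κ × Finset β)) :
    |remAt (prec blk Δ W (corner ℝ W)) Cov trig (src blk ℱ W) c legs obs M χ oc vc reg [] 0 O 𝒳
        / ∫ φ, weight (prec blk Δ W (corner ℝ W)) φ * source (src blk ℱ W) φ|
      ≤ Kχ * Λ * (Wc ^ (∑ j ∈ O, ((obs j).length + 1 + M * maxArity legs)) * ∏ j ∈ O, Bl ^ (obs j).length)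
        * (θ ^ nfreeOf oc 𝒳 * (max ηχ (max (θv ^ M) θw)) ^ Multiset.card 𝒳) := by
  have hs0 : 0 < max ηχ (max (θv ^ M) θw) := lt_max_of_lt_right (lt_max_of_lt_right hθw)
  have h := sum_abs_remAt_div_weighted_le_N (oc := oc) (vc := vc) (reg := reg) (χ := χ) hPD hN0 hNz hθ0 hθ1 hBl hB0
    hρ hcV0 hη0 hη1 hθv hθv1 hθw hθw1 hB hBf hBzN hcV hobs hlegs hloc hwalk hvert hρ₀0 hρ₀ hN₀ O hW1 hW hKχ hΛ hE {𝒳}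
  rw [Finset.sum_singleton] at h
  have hpos : 0 < θ ^ nfreeOf oc 𝒳 * (max ηχ (max (θv ^ M) θw)) ^ Multiset.card 𝒳 :=
    mul_pos (pow_pos hθ0 _) (pow_pos hs0 _)
  rw [← mul_inv, ← div_eq_mul_inv, div_le_iff₀ hpos] at h
  exact h

end Law

end Literature.MathematicalPhysics.QuantumFieldTheory.BalabanImbrieJaffe1984to88.BIJ88WalkRemainderActivityN312

end
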